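import Mathlib
import Summits.Parity.BatemanHorn.Theses.PolynomialMobius

/-!
# Crux `PolyMobiusTail` (stmt-Parity-0870), line `eta-free-multilinear-window`:
# localisation of the parity core `stub_large`

The lead's skeleton `Summits/Parity/BatemanHorn/Cruxes/PolyMobiusTail/Lines/eta_free_multilinear_window.lean`
cuts the crux's Möbius tail `Tail_η(x) = Σ_{n ≤ x} Σ_{dᵢ ∣ fᵢ(n), x^{1-η} < ∏ dᵢ} ∏ μ(dᵢ) log dᵢ` EXACTLY as
`Tail_η = Win_{η,θ} + Large_θ` (window `x^{1-η} < ∏ dᵢ ≤ x^{1+θ}`, large part `x^{1+θ} < ∏ dᵢ`), and rewrites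
the large part in COFACTOR form by the involution `d ↦ f(n)/d` (registered stub `stub_large`: the cofactor
large part is `o(x)` for every system and every `θ ∈ (0,1)` — the parity core, open).

This file certifies the line card's "honest localisation" as a theorem (aux stub
`stub_large_iff_tail_of_window`): for ANY tuple of integer polynomials `f`, any `0 < η`, `0 ≤ θ`, GIVEN that
the window `Win_{η,θ}` is `o(x)`, the conclusion of `stub_large` for `f` at `θ` is EQUIVALENT to the crux's
tail conclusion `Tail_η = o(x)` for `f` at `η`.  So on every slice where the window stubs are proved,
`stub_large` is exactly crux-strength — the line relocates parity into `stub_large`, it does not shrink it.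
Pure bookkeeping (`IsLittleO.add/.sub`, the divisor switch, the range split); no Bateman–Horn axiom is used.

The two glue lemmas `large_divisor_switch`, `tail_eq_window_add_large` are the skeleton's (proofs copied from
`Lines/eta_free_multilinear_window.lean`), restated WITHOUT auxiliary definitions (sums written out), so that
the file is theorems-only.
-/

open scoped BigOperators
open Filter Finset Polynomial Asymptotics

namespace Summit.Parity.BatemanHorn.Theorems.PolyMobiusTail.EtaFreeWindow

open Literature.NumberTheory.Sieve

namespace Localisation

/-- **Coordinatewise divisor involution.** For `m : Fin k → ℕ` and any `F`, summing `F d` over the divisor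
tuples `d` of `m` equals summing `F (m/e)` over the divisor tuples `e` of `m`: `d ↦ (mᵢ/dᵢ)ᵢ` is an
involution of `∏ᵢ divisors(mᵢ)` (`Nat.div_div_self`; tuples exist only when every `mᵢ ≠ 0`). -/
theorem sum_piFinset_divisors_switch {k : ℕ} (m : Fin k → ℕ) (F : (Fin k → ℕ) → ℝ) :
    ∑ d ∈ Fintype.piFinset (fun i => (m i).divisors), F d =
      ∑ e ∈ Fintype.piFinset (fun i => (m i).divisors), F (fun i => m i / e i) := by
  have hmem : ∀ d : Fin k → ℕ, d ∈ Fintype.piFinset (fun i => (m i).divisors) →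
      ∀ i, d i ∣ m i ∧ m i ≠ 0 := fun d hd i =>
    Nat.mem_divisors.mp ((Fintype.mem_piFinset.mp hd) i)
  have hmap : ∀ d : Fin k → ℕ, d ∈ Fintype.piFinset (fun i => (m i).divisors) →
      (fun i => m i / d i) ∈ Fintype.piFinset (fun i => (m i).divisors) := by
    intro d hd
    refine Fintype.mem_piFinset.mpr fun i => Nat.mem_divisors.mpr ⟨?_, (hmem d hd i).2⟩
    exact Nat.div_dvd_of_dvd (hmem d hd i).1
  have hinv : ∀ d : Fin k → ℕ, d ∈ Fintype.piFinset (fun i => (m i).divisors) →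
      (fun i => m i / (m i / d i)) = d := by
    intro d hd
    funext i
    exact Nat.div_div_self (hmem d hd i).1 (hmem d hd i).2
  refine Finset.sum_nbij' (fun d i => m i / d i) (fun e i => m i / e i) hmap hmap hinv hinv ?_
  intro d hd
  exact congrArg F (hinv d hd).symm

/-- **Divisor switch** (the skeleton's `large_divisor_switch`, sums written out). For every `x`, the large
part `Σ_{n≤x} Σ_{dᵢ∣fᵢ(n), x^{1+θ} < ∏dᵢ} ∏ μ(dᵢ) log dᵢ` in divisor form equals the large part in cofactor
form `Σ_{n≤x} Σ_{eᵢ∣fᵢ(n), x^{1+θ} < ∏ fᵢ(n)/eᵢ} ∏ μ(fᵢ(n)/eᵢ) log(fᵢ(n)/eᵢ)`. -/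
theorem large_divisor_switch {k : ℕ} (f : Fin k → ℤ[X]) (θ : ℝ) (x : ℕ) :
    (∑ n ∈ Finset.Icc 1 x, ∑ d ∈ Fintype.piFinset (fun i => (((f i).eval (n : ℤ)).toNat).divisors),
        if (x : ℝ) ^ (1 + θ) < ∏ i, (d i : ℝ) then
          ∏ i, ((ArithmeticFunction.moebius (d i) : ℝ) * Real.log (d i)) else 0) =
      ∑ n ∈ Finset.Icc 1 x, ∑ e ∈ Fintype.piFinset (fun i => (((f i).eval (n : ℤ)).toNat).divisors),
        if (x : ℝ) ^ (1 + θ) < ∏ i, ((((f i).eval (n : ℤ)).toNat / e i : ℕ) : ℝ) then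
          ∏ i, ((ArithmeticFunction.moebius (((f i).eval (n : ℤ)).toNat / e i) : ℝ) *
            Real.log ((((f i).eval (n : ℤ)).toNat / e i : ℕ) : ℝ)) else 0 := by
  refine Finset.sum_congr rfl fun n _ => ?_
  exact sum_piFinset_divisors_switch (fun i => ((f i).eval (n : ℤ)).toNat)
    (fun d => if (x : ℝ) ^ (1 + θ) < ∏ i, (d i : ℝ) then
      ∏ i, ((ArithmeticFunction.moebius (d i) : ℝ) * Real.log (d i)) else 0)

/-- **Range split** (the skeleton's `tail_eq_window_add_large`, sums written out). For `0 < η`, `0 ≤ θ` and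
every `x`: `Tail_η(x) = Win_{η,θ}(x) + Large_θ(x)` (for `x ≥ 1`, `x^{1-η} ≤ x^{1+θ}` makes the two brackets
complementary inside `x^{1-η} < ∏ dᵢ`; for `x = 0` all three sums are empty). -/
theorem tail_eq_window_add_large {k : ℕ} (f : Fin k → ℤ[X]) {η θ : ℝ} (hη : 0 < η) (hθ : 0 ≤ θ)
    (x : ℕ) :
    (∑ n ∈ Finset.Icc 1 x, ∑ d ∈ Fintype.piFinset (fun i => (((f i).eval (n : ℤ)).toNat).divisors),
        if (x : ℝ) ^ (1 - η) < ∏ i, (d i : ℝ) then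
          ∏ i, ((ArithmeticFunction.moebius (d i) : ℝ) * Real.log (d i)) else 0) =
      (∑ n ∈ Finset.Icc 1 x, ∑ d ∈ Fintype.piFinset (fun i => (((f i).eval (n : ℤ)).toNat).divisors),
        if (x : ℝ) ^ (1 - η) < ∏ i, (d i : ℝ) ∧ ∏ i, (d i : ℝ) ≤ (x : ℝ) ^ (1 + θ) then
          ∏ i, ((ArithmeticFunction.moebius (d i) : ℝ) * Real.log (d i)) else 0) +
      ∑ n ∈ Finset.Icc 1 x, ∑ d ∈ Fintype.piFinset (fun i => (((f i).eval (n : ℤ)).toNat).divisors),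
        if (x : ℝ) ^ (1 + θ) < ∏ i, (d i : ℝ) then
          ∏ i, ((ArithmeticFunction.moebius (d i) : ℝ) * Real.log (d i)) else 0 := by
  rw [← Finset.sum_add_distrib]
  refine Finset.sum_congr rfl fun n hn => ?_
  rw [← Finset.sum_add_distrib]
  refine Finset.sum_congr rfl fun d _ => ?_
  have hx1 : (1 : ℝ) ≤ (x : ℝ) := by
    have h := Finset.mem_Icc.mp hn
    exact_mod_cast h.1.trans h.2
  have hle : (x : ℝ) ^ (1 - η) ≤ (x : ℝ) ^ (1 + θ) :=
    Real.rpow_le_rpow_of_exponent_le hx1 (by linarith)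
  by_cases h1 : ∏ i, (d i : ℝ) ≤ (x : ℝ) ^ (1 + θ)
  · have h2 : ¬ (x : ℝ) ^ (1 + θ) < ∏ i, (d i : ℝ) := not_lt.mpr h1
    by_cases h0 : (x : ℝ) ^ (1 - η) < ∏ i, (d i : ℝ)
    · rw [if_pos h0, if_pos ⟨h0, h1⟩, if_neg h2, add_zero]
    · rw [if_neg h0, if_neg (fun h => h0 h.1), if_neg h2, add_zero]
  · push Not at h1
    have h0 : (x : ℝ) ^ (1 - η) < ∏ i, (d i : ℝ) := lt_of_le_of_lt hle h1
    rw [if_pos h0, if_neg (fun h => (not_le.mpr h1) h.2), if_pos h1, zero_add]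

end Localisation

/-- **Aux stub `stub_large_iff_tail_of_window` — the honest localisation of the parity core.**
For ANY tuple of integer polynomials `f : Fin k → ℤ[X]`, any `0 < η` and `0 ≤ θ`: GIVEN that the window
`Σ_{n≤x} Σ_{dᵢ∣fᵢ(n), x^{1-η} < ∏dᵢ ≤ x^{1+θ}} ∏ μ(dᵢ) log dᵢ` is `o(x)`, the conclusion of the registered
stub `stub_large` for `f` at `θ` (the COFACTOR large part
`Σ_{n≤x} Σ_{eᵢ∣fᵢ(n), x^{1+θ} < ∏ fᵢ(n)/eᵢ} ∏ μ(fᵢ(n)/eᵢ) log(fᵢ(n)/eᵢ) = o(x)`) is EQUIVALENT to the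
crux's tail conclusion at `η` (`Σ_{n≤x} Σ_{dᵢ∣fᵢ(n), x^{1-η} < ∏dᵢ} ∏ μ(dᵢ) log dᵢ = o(x)`, the function
in `PolyMobiusTail`).  Hence on every slice where the window stubs hold, `stub_large` is exactly
crux-strength; no Bateman–Horn axiom is needed for this bookkeeping
(`Tail = Win + Large_divisor`, `Large_divisor = Large_cofactor`, `IsLittleO.add/.sub`). -/
theorem stub_large_iff_tail_of_window : ∀ (k : ℕ) (f : Fin k → ℤ[X]) (η θ : ℝ), 0 < η → 0 ≤ θ →
    ((fun x : ℕ => ∑ n ∈ Finset.Icc 1 x,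
        ∑ d ∈ Fintype.piFinset (fun i => (((f i).eval (n : ℤ)).toNat).divisors),
          if (x : ℝ) ^ (1 - η) < ∏ i, (d i : ℝ) ∧ ∏ i, (d i : ℝ) ≤ (x : ℝ) ^ (1 + θ) then
            ∏ i, ((ArithmeticFunction.moebius (d i) : ℝ) * Real.log (d i)) else 0)
      =o[atTop] fun x : ℕ => (x : ℝ)) →
    (((fun x : ℕ => ∑ n ∈ Finset.Icc 1 x,
        ∑ e ∈ Fintype.piFinset (fun i => (((f i).eval (n : ℤ)).toNat).divisors),
          if (x : ℝ) ^ (1 + θ) < ∏ i, ((((f i).eval (n : ℤ)).toNat / e i : ℕ) : ℝ) then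
            ∏ i, ((ArithmeticFunction.moebius (((f i).eval (n : ℤ)).toNat / e i) : ℝ) *
              Real.log ((((f i).eval (n : ℤ)).toNat / e i : ℕ) : ℝ)) else 0)
      =o[atTop] fun x : ℕ => (x : ℝ)) ↔
    ((fun x : ℕ => ∑ n ∈ Finset.Icc 1 x,
        ∑ d ∈ Fintype.piFinset (fun i => (((f i).eval (n : ℤ)).toNat).divisors),
          if (x : ℝ) ^ (1 - η) < ∏ i, (d i : ℝ) then
            ∏ i, ((ArithmeticFunction.moebius (d i) : ℝ) * Real.log (d i)) else 0)
      =o[atTop] fun x : ℕ => (x : ℝ))) := by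
  intro k f η θ hη hθ hW
  have hsplit := fun x : ℕ => Localisation.tail_eq_window_add_large f hη hθ x
  have hswitch := fun x : ℕ => Localisation.large_divisor_switch f θ x
  constructor
  · intro hE
    have hD := hE.congr_left fun x => (hswitch x).symm
    exact (hW.add hD).congr_left fun x => (hsplit x).symm
  · intro hT
    exact (hT.sub hW).congr_left fun x => by rw [hsplit x, add_sub_cancel_left, hswitch x]

/-- **Joint sufficiency on a slice (corollary).** For any tuple `f`: a window at `(η, θ)` with
`0 < η < 1`, `0 ≤ θ` that is `o(x)`, together with the conclusion of `stub_large` for `f` at `θ`, gives the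
crux's conclusion for `f`, i.e. `∃ η ∈ (0,1)` with the Möbius tail `o(x)` (the `f`-slice of
`PolyMobiusTail`). -/
theorem tail_slice_of_window_of_large {k : ℕ} (f : Fin k → ℤ[X]) {η θ : ℝ} (hη0 : 0 < η) (hη1 : η < 1)
    (hθ : 0 ≤ θ)
    (hW : (fun x : ℕ => ∑ n ∈ Finset.Icc 1 x,
        ∑ d ∈ Fintype.piFinset (fun i => (((f i).eval (n : ℤ)).toNat).divisors),
          if (x : ℝ) ^ (1 - η) < ∏ i, (d i : ℝ) ∧ ∏ i, (d i : ℝ) ≤ (x : ℝ) ^ (1 + θ) then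
            ∏ i, ((ArithmeticFunction.moebius (d i) : ℝ) * Real.log (d i)) else 0)
      =o[atTop] fun x : ℕ => (x : ℝ))
    (hE : (fun x : ℕ => ∑ n ∈ Finset.Icc 1 x,
        ∑ e ∈ Fintype.piFinset (fun i => (((f i).eval (n : ℤ)).toNat).divisors),
          if (x : ℝ) ^ (1 + θ) < ∏ i, ((((f i).eval (n : ℤ)).toNat / e i : ℕ) : ℝ) then
            ∏ i, ((ArithmeticFunction.moebius (((f i).eval (n : ℤ)).toNat / e i) : ℝ) *
              Real.log ((((f i).eval (n : ℤ)).toNat / e i : ℕ) : ℝ)) else 0)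
      =o[atTop] fun x : ℕ => (x : ℝ)) :
    ∃ η : ℝ, 0 < η ∧ η < 1 ∧
      (fun x : ℕ => ∑ n ∈ Finset.Icc 1 x,
        ∑ d ∈ Fintype.piFinset (fun i => (((f i).eval (n : ℤ)).toNat).divisors),
          if (x : ℝ) ^ (1 - η) < ∏ i, (d i : ℝ) then
            ∏ i, ((ArithmeticFunction.moebius (d i) : ℝ) * Real.log (d i)) else 0)
        =o[atTop] fun x : ℕ => (x : ℝ) :=
  ⟨η, hη0, hη1, (stub_large_iff_tail_of_window k f η θ hη0 hθ hW).mp hE⟩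

end Summit.Parity.BatemanHorn.Theorems.PolyMobiusTail.EtaFreeWindow
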